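import Summits.CriticalPhenomena.PercolationContinuityZ3.Theorems.PercNearOneGluingNoHeavyQuantSizeBiasedSiblingStep
import HarnessLib

/-!
# QUANT lane R8, T-DEC: THE SUB-PRODUCT MIXTURE CRITERION — EVERY decomposition of a forest's root-pattern law into sub-product measures
# (re-gated sub-forests) is a kernel instance of the sibling step for all outer gates `a ≤ min_c m_c / fmean L`, GIVEN the `GateStepN` /
# `SiblingStep` oracle; U-RPM (arm-1 g53), the open-set size bias (census-1 g26) and the LP certificates of the census are its instances

builds on p205010 (kernel theorem, internal audit signed; external expert review pending)

Support file (`--supports stmt-CriticalPhenomena-4575`), QUANT lane seat prim-quant-census-1 (gen 26), rung R8 of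
`run/shared/lean/prim/quant/LADDER.md`; memo `run/shared/lean/prim/quant/prim-quant-census-1/g26/SIZEBIAS-G26.md` §4–§6.  Theorems only, standard
axioms, no sorries.  Sequel of ✓ `…QuantSizeBiasedSiblingStep` (p500581); vocabulary of census-1 g25's ✓ `…QuantURPMLaw` (`patLaw`, `flaw_pattern`,
`subRegate`, `flaw_subRegate`) and prim-quant-stmt g39's list binder.

THE REFORMULATION (memo §4).  Write `π_A = Π_{i∈A} qᵢ Π_{i∉A} (1 − qᵢ)` for the root-pattern law of the sibling list `L` and, for a position set `E` with
root gates `o : E → (0,1]`, `P_{E,o}(A) = Π_{i∈A} oᵢ Π_{i∈E∖A} (1 − oᵢ)` (`A ⊆ E`; else `0`) for the pattern law of the re-gated sub-forest `L|_E^o`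
(`subRegate L E o`, gated mean `m_{E,o} = Σ_{i∈E} oᵢ mᵢ`).  A SUB-PRODUCT DECOMPOSITION of `L` is a finite family `(u_c ≥ 0, E_c, o_c)` with
    `Σ_c u_c · P_{E_c,o_c}(A) = π_A`   for every NON-EMPTY pattern `A`.
Then for EVERY outer gate `a`:  `gate_a (flaw L) = Σ_c w_c · gate_{b_c} (flaw (L|_{E_c}^{o_c}))` with `w_c = u_c m_c / fmean L` (`Σ_c w_c = 1`, because
`Σ_c u_c m_c = Σ_{A≠∅} π_A m_A = fmean L`) and `b_c = a · fmean L / m_c` — ALL components at the common mean `a · fmean L` (`gate_flaw_eq_subproductMix`);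
the `δ₀`-masses balance by `Σ_c u_c (1 − P_c(∅)) = 1 − π_∅`.  Consequently (`decAt_gate_flaw_of_subproductMix`): if every component is ORACLE-LEGAL
(a sibling dropped, `E_c ≠ univ`, or one root fully opened, some `o_c i = 1` — then `L|_{E_c}^{o_c}` is tree-built with FEWER than `fgates L` nontrivial
gates, `treeBuiltN_flaw_strict`) and its floor does not bind (`x · m_c ≤ fmean L · v_c`, `v_c ≤ o_c i · x₁ᵢ` on `E_c`), the gated forest `gate_a (flaw L)`
is DEC at floor `a·x` at every layer for every `0 < a ≤ min(1, min_c m_c / fmean L)`; and (`sdec_flaw_of_subproductMix`) if `min_c m_c ≥ fmean L` the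
forest is SDEC at its TRUE floor.  So the free range of outer gates obtainable from mean-certified sub-forest mixtures is
`a_mix(L) = sup_D min_c m_c(D) / fmean L` over legal, floor-compatible decompositions `D` — a finite-dimensional LP per forest shape, whose solutions this
file turns into kernel instances of the sibling step.  INSTANCES: the open-set size bias (`u_E = π_E`, `o ≡ 1`; ✓ p500581: `a ≤ min mᵢ / fmean L`),
arm-1 g53's U-RPM (head fully open, proportional openness, all `m_c` equal; ✓ p496166), and (memo §5, exact LP) e.g. three identical siblings with
`q ≤ 1/2`: `u = (1−q)/6` on the six ordered pairs with openness `(q, 2q)`, `q²(1−q)/3` on the six ordered pairs `(1, 1/2)`, `q³` on the open triple —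
all means `≥ 3q·m = fmean`, floors tight; census: `a_mix ≥ 1` iff `(k−1)q ≤ 1` for `k = 3, 4, 5` identical relays (exact LP, openness grids 5–10).

HONEST STATUS.  A criterion (sufficient condition) for the open node on the family it certifies; `SiblingStep` ⟺ `GateStepN`, `UPartStep`,
`LightResidDECOracle`, `FarTreeRow` remain OPEN; RATE class (log\*) and the honest sentence of `run/shared/lean/prim/quant/README.md` unchanged.
[this work]; nothing here is cited as a published result.  The gluing rows served [cite: KozmaNitzan2024, Conjecture 3 (p. 15)]; product measure
[cite: Grimmett1999, §1.3 p. 10].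
-/

noncomputable section

open scoped BigOperators

namespace Summit.CriticalPhenomena.PercolationContinuityZ3.Theorems
namespace Quant
namespace LawDec

open Finset

/-! ### Tools: the mean of a pattern law; tree-built certificates with a STRICT gate count -/

/-- **the mean of the pattern law `X_A` over the full range `{0..ftop L}` is `Σ_{i∈A} mᵢ`** (`= fmean (subRegate L A 1)`). [this work] -/
theorem sum_mul_patLaw (L : List Sib) (hL : ∀ t ∈ L, t.LawOK) (A : Finset (Fin L.length)) :
    ∑ h ∈ Finset.range (ftop L + 1), (h : ℝ) * patLaw L A h = ∑ i ∈ A, (L.get i).mean := by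
  have hget : ∀ i : Fin L.length, (L.get i).LawOK := fun i => hL _ (List.get_mem L i)
  rw [← fmean_subRegate_one, Finset.sum_congr rfl fun h _ => by rw [← flaw_subRegate_one L A h]]
  have hK : ∀ t ∈ subRegate L A (fun _ => (1 : ℝ)), 0 ≤ t.q ∧ t.q ≤ 1 ∧ (∀ h, 0 ≤ t.ρ h) ∧ (∀ h, t.M < h → t.ρ h = 0) ∧
      ∑ h ∈ Finset.range (t.M + 1), t.ρ h = 1 := by
    intro t ht
    obtain ⟨i, _, rfl⟩ := (mem_subRegate L A _ t).1 ht
    obtain ⟨_, _, ρ0, ρM, ρ1⟩ := hget i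
    exact ⟨zero_le_one, le_rfl, ρ0, ρM, ρ1⟩
  obtain ⟨_, _, _, cmn⟩ := flaw_facts_weak (subRegate L A (fun _ => (1 : ℝ))) hK
  have hsub : Finset.range (ftop (subRegate L A (fun _ => (1 : ℝ))) + 1) ⊆ Finset.range (ftop L + 1) := by
    have hle := ftop_subRegate_le L A (fun _ => (1 : ℝ))
    exact Finset.range_subset_range.2 (by omega)
  rw [← cmn]
  symm
  refine Finset.sum_subset hsub ?_
  intro h _ hnot
  have hlt : ftop (subRegate L A (fun _ => (1 : ℝ))) < h := by
    rw [Finset.mem_range] at hnot; omega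
  rw [flaw_eq_zero_of_lt _ h hlt, mul_zero]

/-- **tree-built certificate of a re-gated forest with a STRICT gate count**: siblings with root gates in `(0,1]`, tree-built sub-forests and a common
floor bound `v ≤ qₜ·x₁ₜ` form a `TreeBuiltN` law at `v` with at most `fgates K` nontrivial gates, and STRICTLY fewer as soon as one root gate equals `1`
(a sure gate costs nothing: `gate_one`). [this work] -/
theorem treeBuiltN_flaw_strict {v : ℝ} (hv0 : 0 < v) (hv1 : v < 1) :
    ∀ K : List Sib, (∀ t ∈ K, 0 < t.q ∧ t.q ≤ 1 ∧ TreeBuiltN t.x₁ t.n t.M t.ρ ∧ v ≤ t.q * t.x₁) →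
      ∃ n', n' ≤ fgates K ∧ ((∃ t ∈ K, t.q = 1) → n' < fgates K) ∧ TreeBuiltN v n' (ftop K) (flaw K)
  | [], _ => ⟨0, le_rfl, fun ⟨t, ht, _⟩ => by simp at ht, TreeBuiltN.nil v hv0 hv1⟩
  | t :: K, hK => by
    obtain ⟨hq0, hq1, hT, hvq⟩ := hK t List.mem_cons_self
    obtain ⟨n'', hn'', hstrict, hF⟩ := treeBuiltN_flaw_strict hv0 hv1 K (fun u hu => hK u (List.mem_cons_of_mem t hu))
    have hb : TreeBuiltN (v / t.q) t.n t.M t.ρ := by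
      refine TreeBuiltN.mono hT (div_pos hv0 hq0) ?_
      rw [div_le_iff₀ hq0, mul_comm]; exact hvq
    rcases eq_or_lt_of_le hq1 with hq | hq
    · -- a sure root gate: no gate spent
      have hG : TreeBuiltN v t.n t.M (gate t.ρ t.q) := by
        rw [hq, gate_one]; rw [hq, div_one] at hb; exact hb
      refine ⟨n'' + t.n, ?_, fun _ => ?_, TreeBuiltN.conv hF hG⟩
      · show n'' + t.n ≤ fgates K + (t.n + 1); omega
      · show n'' + t.n < fgates K + (t.n + 1); omega
    · have hG : TreeBuiltN (t.q * (v / t.q)) (t.n + 1) t.M (gate t.ρ t.q) := TreeBuiltN.gate t.q hq0 hq hb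
      have e : t.q * (v / t.q) = v := by field_simp
      rw [e] at hG
      refine ⟨n'' + (t.n + 1), ?_, fun ⟨t', ht', hq'⟩ => ?_, TreeBuiltN.conv hF hG⟩
      · show n'' + (t.n + 1) ≤ fgates K + (t.n + 1); omega
      · rcases List.mem_cons.1 ht' with rfl | ht'
        · exact absurd hq' (ne_of_lt hq)
        · have := hstrict ⟨t', ht', hq'⟩
          show n'' + (t.n + 1) < fgates K + (t.n + 1); omega

/-! ### The sub-product mixture identity -/

/-- **THE SUB-PRODUCT MIXTURE IDENTITY (law level, every width, every outer gate).**  For law-OK siblings with positive opened means and a sub-product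
decomposition `Σ_c u_c P_{E_c,o_c}(A) = π_A` (`A ≠ ∅`) whose components have positive gated means `m_c = fmean (subRegate L (E c) (o c))`:
`gate_a (flaw L) h = Σ_c (u_c m_c / fmean L) · gate_{a·fmean L/m_c} (flaw (subRegate L (E c) (o c))) h`, and the weights sum to `1`. [this work] -/
theorem gate_flaw_eq_subproductMix (L : List Sib) (hL : ∀ t ∈ L, t.LawOK) (hmpos : ∀ i : Fin L.length, 0 < (L.get i).mean) (hne : L ≠ [])
    {ι : Type*} (S : Finset ι) (u : ι → ℝ) (E : ι → Finset (Fin L.length)) (o : ι → Fin L.length → ℝ)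
    (ho0 : ∀ c ∈ S, ∀ i ∈ E c, 0 ≤ o c i) (ho1 : ∀ c ∈ S, ∀ i ∈ E c, o c i ≤ 1)
    (hmc : ∀ c ∈ S, 0 < fmean (subRegate L (E c) (o c)))
    (hpat : ∀ A : Finset (Fin L.length), A.Nonempty →
      ∑ c ∈ S, u c * (if A ⊆ E c then (∏ i ∈ A, o c i) * ∏ i ∈ E c \ A, (1 - o c i) else 0)
        = (∏ i ∈ A, (L.get i).q) * ∏ i ∈ Finset.univ \ A, (1 - (L.get i).q))
    (a : ℝ) :
    (∑ c ∈ S, u c * fmean (subRegate L (E c) (o c)) / fmean L = 1) ∧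
    ∀ h, gate (flaw L) a h = ∑ c ∈ S, (u c * fmean (subRegate L (E c) (o c)) / fmean L) *
      gate (flaw (subRegate L (E c) (o c))) (a * fmean L / fmean (subRegate L (E c) (o c))) h := by
  classical
  have hfm : 0 < fmean L := fmean_pos_of_ne_nil L hL hmpos hne
  set Pw : Finset (Finset (Fin L.length)) := (Finset.univ : Finset (Fin L.length)).powerset with hPw
  set piE : Finset (Fin L.length) → ℝ := fun A => (∏ i ∈ A, (L.get i).q) * ∏ i ∈ Finset.univ \ A, (1 - (L.get i).q)
    with hpiEdef
  set coef : ι → Finset (Fin L.length) → ℝ :=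
    fun c A => if A ⊆ E c then (∏ i ∈ A, o c i) * ∏ i ∈ E c \ A, (1 - o c i) else 0 with hcoefdef
  set cmp : ι → List Sib := fun c => subRegate L (E c) (o c) with hcmpdef
  set mA : Finset (Fin L.length) → ℝ := fun A => ∑ i ∈ A, (L.get i).mean with hmAdef
  -- (I1) the law of each component over the full pattern index
  have hsubx : ∀ c h, flaw (cmp c) h = ∑ A ∈ Pw, coef c A * patLaw L A h := by
    intro c h
    show flaw (subRegate L (E c) (o c)) h = _
    rw [flaw_subRegate]
    have e : ∀ A ∈ Pw, coef c A * patLaw L A h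
        = if A ⊆ E c then ((∏ i ∈ A, o c i) * ∏ i ∈ E c \ A, (1 - o c i)) * patLaw L A h else 0 := by
      intro A _
      show (if A ⊆ E c then (∏ i ∈ A, o c i) * ∏ i ∈ E c \ A, (1 - o c i) else 0) * patLaw L A h = _
      split_ifs <;> simp
    rw [Finset.sum_congr rfl e, ← Finset.sum_filter]
    refine Finset.sum_congr ?_ fun A _ => rfl
    ext A
    simp only [Finset.mem_powerset, Finset.mem_filter, hPw, Finset.subset_univ, true_and]
  -- (I2) each coefficient family has total mass `1`
  have hcoef1 : ∀ c, ∑ A ∈ Pw, coef c A = 1 := by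
    intro c
    have e : ∀ A ∈ Pw, coef c A = if A ⊆ E c then (∏ i ∈ A, o c i) * ∏ i ∈ E c \ A, (1 - o c i) else 0 := fun A _ => rfl
    rw [Finset.sum_congr rfl e, ← Finset.sum_filter]
    have ef : Pw.filter (fun A => A ⊆ E c) = (E c).powerset := by
      ext A
      simp only [Finset.mem_powerset, Finset.mem_filter, hPw, Finset.subset_univ, true_and]
    rw [ef, ← Finset.prod_add]
    exact Finset.prod_eq_one fun i _ => by ring
  -- (I3) the gated mean of each component is the `coef`-average of the pattern means
  have hmean : ∀ c ∈ S, fmean (cmp c) = ∑ A ∈ Pw, coef c A * mA A := by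
    intro c hc
    have hK : ∀ t ∈ cmp c, 0 ≤ t.q ∧ t.q ≤ 1 ∧ (∀ h, 0 ≤ t.ρ h) ∧ (∀ h, t.M < h → t.ρ h = 0) ∧
        ∑ h ∈ Finset.range (t.M + 1), t.ρ h = 1 := by
      intro t ht
      obtain ⟨i, hi, rfl⟩ := (mem_subRegate L (E c) _ t).1 ht
      obtain ⟨_, _, ρ0, ρM, ρ1⟩ := hL _ (List.get_mem L i)
      exact ⟨ho0 c hc i hi, ho1 c hc i hi, ρ0, ρM, ρ1⟩
    obtain ⟨_, _, _, cmn⟩ := flaw_facts_weak (cmp c) hK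
    have hsub : Finset.range (ftop (cmp c) + 1) ⊆ Finset.range (ftop L + 1) := by
      have hle := ftop_subRegate_le L (E c) (o c)
      exact Finset.range_subset_range.2 (by show ftop (subRegate L (E c) (o c)) + 1 ≤ ftop L + 1; omega)
    have ext : ∑ h ∈ Finset.range (ftop L + 1), (h : ℝ) * flaw (cmp c) h = fmean (cmp c) := by
      rw [← cmn]; symm
      refine Finset.sum_subset hsub ?_
      intro h _ hnot
      have hlt : ftop (cmp c) < h := by rw [Finset.mem_range] at hnot; omega
      rw [flaw_eq_zero_of_lt _ h hlt, mul_zero]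
    rw [← ext]
    have e1 : ∀ h : ℕ, (h : ℝ) * flaw (cmp c) h = ∑ A ∈ Pw, coef c A * ((h : ℝ) * patLaw L A h) := by
      intro h
      rw [hsubx c h, Finset.mul_sum]
      exact Finset.sum_congr rfl fun A _ => by ring
    rw [Finset.sum_congr rfl fun h _ => e1 h, Finset.sum_comm]
    refine Finset.sum_congr rfl fun A _ => ?_
    rw [← Finset.mul_sum, sum_mul_patLaw L hL A]
  -- (I4) the pattern identity in the form `Σ_c u_c coef c A = π_A` for `A ≠ ∅`, and the empty pattern
  have hpat' : ∀ A ∈ Pw.erase ∅, ∑ c ∈ S, u c * coef c A = piE A := fun A hA =>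
    hpat A (Finset.nonempty_iff_ne_empty.2 (Finset.ne_of_mem_erase hA))
  have hUC : ∑ c ∈ S, u c * (1 - coef c ∅) = 1 - piE ∅ := by
    have e : ∀ c ∈ S, u c * (1 - coef c ∅) = ∑ A ∈ Pw.erase ∅, u c * coef c A := by
      intro c _
      rw [← Finset.mul_sum, ← hcoef1 c, ← Finset.add_sum_erase Pw (coef c) (Finset.empty_mem_powerset _)]
      ring
    rw [Finset.sum_congr rfl e, Finset.sum_comm, Finset.sum_congr rfl hpat', ← sum_pi_eq_one L,
      ← Finset.add_sum_erase Pw piE (Finset.empty_mem_powerset _)]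
    ring
  -- (I5) the weights sum to one
  have hw1 : ∑ c ∈ S, u c * fmean (cmp c) / fmean L = 1 := by
    rw [← Finset.sum_div, div_eq_one_iff_eq hfm.ne']
    have e : ∀ c ∈ S, u c * fmean (cmp c) = ∑ A ∈ Pw, mA A * (u c * coef c A) := by
      intro c hc
      rw [hmean c hc, Finset.mul_sum]
      exact Finset.sum_congr rfl fun A _ => by ring
    rw [Finset.sum_congr rfl e, Finset.sum_comm]
    have e2 : ∀ A ∈ Pw, ∑ c ∈ S, mA A * (u c * coef c A) = piE A * mA A := by
      intro A hA
      rw [← Finset.mul_sum]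
      by_cases hA0 : A = ∅
      · rw [hA0]; show (∑ i ∈ (∅ : Finset (Fin L.length)), (L.get i).mean) * _ = piE ∅ * ∑ i ∈ (∅ : Finset _), (L.get i).mean
        simp
      · rw [hpat' A (Finset.mem_erase.2 ⟨hA0, hA⟩), mul_comm]
    rw [Finset.sum_congr rfl e2]
    have e3 : ∀ A ∈ Pw, piE A * mA A = piE A * fmean (subRegate L A (fun _ => (1 : ℝ))) := by
      intro A _; rw [fmean_subRegate_one]
    rw [Finset.sum_congr rfl e3]
    exact sum_pi_mul_fmean_subRegate_one L hL
  refine ⟨hw1, fun h => ?_⟩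
  -- (I6) the identity at `h`
  have hterm : ∀ c ∈ S, (u c * fmean (cmp c) / fmean L) * gate (flaw (cmp c)) (a * fmean L / fmean (cmp c)) h
      = a * (u c * flaw (cmp c) h) + (if h = 0 then (1 : ℝ) else 0) * (u c * fmean (cmp c) / fmean L - a * u c) := by
    intro c hc
    have h1 : fmean (cmp c) ≠ 0 := (hmc c hc).ne'
    have h2 := hfm.ne'
    have hlb : (u c * fmean (cmp c) / fmean L) * (a * fmean L / fmean (cmp c)) = a * u c := by
      field_simp
    rw [gate_apply]
    calc (u c * fmean (cmp c) / fmean L) * (a * fmean L / fmean (cmp c) * flaw (cmp c) h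
          + (1 - a * fmean L / fmean (cmp c)) * (if h = 0 then (1 : ℝ) else 0))
        = ((u c * fmean (cmp c) / fmean L) * (a * fmean L / fmean (cmp c))) * flaw (cmp c) h
          + (if h = 0 then (1 : ℝ) else 0) * (u c * fmean (cmp c) / fmean L
              - (u c * fmean (cmp c) / fmean L) * (a * fmean L / fmean (cmp c))) := by ring
      _ = _ := by rw [hlb]; ring
  rw [Finset.sum_congr rfl hterm, Finset.sum_add_distrib, ← Finset.mul_sum, ← Finset.mul_sum, Finset.sum_sub_distrib, hw1,
    ← Finset.mul_sum]
  -- `Σ_c u_c flaw(cmp c) h = Σ_{A≠∅} π_A pat_A h + pat_∅ h · Σ_c u_c coef c ∅`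
  have hmix : ∑ c ∈ S, u c * flaw (cmp c) h
      = ∑ A ∈ Pw.erase ∅, piE A * patLaw L A h + patLaw L ∅ h * ∑ c ∈ S, u c * coef c ∅ := by
    have e : ∀ c ∈ S, u c * flaw (cmp c) h = ∑ A ∈ Pw, patLaw L A h * (u c * coef c A) := by
      intro c _
      rw [hsubx c h, Finset.mul_sum]
      exact Finset.sum_congr rfl fun A _ => by ring
    rw [Finset.sum_congr rfl e, Finset.sum_comm, ← Finset.add_sum_erase Pw _ (Finset.empty_mem_powerset _), ← Finset.mul_sum,
      add_comm]
    congr 1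
    refine Finset.sum_congr rfl fun A hA => ?_
    rw [← Finset.mul_sum, hpat' A hA, mul_comm]
  have A2 : flaw L h = ∑ A ∈ Pw, piE A * patLaw L A h := flaw_pattern L h
  have A3 : ∑ A ∈ Pw, piE A * patLaw L A h = piE ∅ * patLaw L ∅ h + ∑ A ∈ Pw.erase ∅, piE A * patLaw L A h :=
    (Finset.add_sum_erase Pw _ (Finset.empty_mem_powerset _)).symm
  have hU : ∑ c ∈ S, u c = (1 - piE ∅) + ∑ c ∈ S, u c * coef c ∅ := by
    rw [← hUC, ← Finset.sum_add_distrib]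
    exact Finset.sum_congr rfl fun c _ => by ring
  rw [hmix, gate_apply, A2, A3, patLaw_empty, hU]
  split_ifs <;> ring

/-! ### The criterion -/

/-- **THE SUB-PRODUCT MIXTURE CRITERION (DEC form).**  See the module docstring: a non-empty list of tree-built siblings at floor `x`, the oracle below
`fgates L`, and a sub-product decomposition `(u_c, E_c, o_c)_{c∈S}` of the root-pattern law on non-empty patterns whose components are oracle-legal
(`∃ i, i ∉ E_c ∨ o_c i = 1`), have root gates in `(0,1]`, floors that do not bind (`x·m_c ≤ fmean L·v_c` with `0 < v_c ≤ o_c i·x₁ᵢ` on `E_c`) and gated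
means `m_c ≥ a·fmean L` — then `gate_a (flaw L)` is DEC at floor `a·x` at every layer `j < ftop L` (`0 < a ≤ 1`). [this work] -/
theorem decAt_gate_flaw_of_subproductMix {x a : ℝ} (hx0 : 0 < x) (hx1 : x < 1) (L : List Sib)
    (hL : ∀ t ∈ L, t.TreeOK x) (hne : L ≠ [])
    (hO : ∀ (x' : ℝ) (n' M' : ℕ) (μ' : ℕ → ℝ), n' < fgates L → TreeBuiltN x' n' M' μ' → SDEC x' M' μ')
    {ι : Type*} (S : Finset ι) (u : ι → ℝ) (E : ι → Finset (Fin L.length)) (o : ι → Fin L.length → ℝ)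
    (hu0 : ∀ c ∈ S, 0 ≤ u c)
    (ho0 : ∀ c ∈ S, ∀ i ∈ E c, 0 < o c i) (ho1 : ∀ c ∈ S, ∀ i ∈ E c, o c i ≤ 1)
    (hlegal : ∀ c ∈ S, ∃ i, i ∉ E c ∨ o c i = 1)
    (hpat : ∀ A : Finset (Fin L.length), A.Nonempty →
      ∑ c ∈ S, u c * (if A ⊆ E c then (∏ i ∈ A, o c i) * ∏ i ∈ E c \ A, (1 - o c i) else 0)
        = (∏ i ∈ A, (L.get i).q) * ∏ i ∈ Finset.univ \ A, (1 - (L.get i).q))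
    (v : ι → ℝ) (hv0 : ∀ c ∈ S, 0 < v c) (hv : ∀ c ∈ S, ∀ i ∈ E c, v c ≤ o c i * (L.get i).x₁)
    (hfloor : ∀ c ∈ S, x * fmean (subRegate L (E c) (o c)) ≤ fmean L * v c)
    (ha0 : 0 < a) (ha1 : a ≤ 1) (ham : ∀ c ∈ S, a * fmean L ≤ fmean (subRegate L (E c) (o c))) :
    ∀ j, j < ftop L → DECAt (a * x) j (ftop L) (gate (flaw L) a) := by
  classical
  intro j _
  have hL' : ∀ t ∈ L, t.LawOK := fun t ht => (hL t ht).lawOK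
  have hget : ∀ i : Fin L.length, (L.get i).TreeOK x := fun i => hL _ (List.get_mem L i)
  have hmpos : ∀ i : Fin L.length, 0 < (L.get i).mean := fun i => (L.get i).mean_pos (hget i)
  have hfm : 0 < fmean L := fmean_pos_of_ne_nil L hL' hmpos hne
  set z : ℝ := a * x with hzdef
  have hz1 : z < 1 := by rw [hzdef]; nlinarith
  set TE : ℝ := a * fmean L with hTEdef
  set cmp : ι → List Sib := fun c => subRegate L (E c) (o c) with hcmpdef
  set w : ι → ℝ := fun c => u c * fmean (cmp c) / fmean L with hwdef
  set b : ι → ℝ := fun c => a * fmean L / fmean (cmp c) with hbdef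
  have hmc : ∀ c ∈ S, 0 < fmean (cmp c) := fun c hc => lt_of_lt_of_le (mul_pos ha0 hfm) (ham c hc)
  obtain ⟨hw1, e⟩ := gate_flaw_eq_subproductMix L hL' hmpos hne S u E o (fun c hc i hi => (ho0 c hc i hi).le) ho1 hmc hpat a
  have hw0 : ∀ c ∈ S, 0 ≤ w c := fun c hc => div_nonneg (mul_nonneg (hu0 c hc) (hmc c hc).le) hfm.le
  have hb0 : ∀ c ∈ S, 0 < b c := fun c hc => div_pos (mul_pos ha0 hfm) (hmc c hc)
  have hb1 : ∀ c ∈ S, b c ≤ 1 := fun c hc => by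
    show a * fmean L / fmean (cmp c) ≤ 1
    rw [div_le_one (hmc c hc)]; exact ham c hc
  -- each component: ONE oracle call at floor `v c`
  have hUE : ∀ c ∈ S, 0 < w c → DECAtT z TE j (ftop L) (gate (flaw (cmp c)) (b c)) := by
    intro c hc _
    have hv1 : v c < 1 := by
      -- the component has a member (its mean is positive), whose sub-forest floor is `< 1`
      have hEne : (E c).Nonempty := by
        by_contra h0
        rw [Finset.not_nonempty_iff_eq_empty] at h0
        have := hmc c hc
        rw [hcmpdef] at this; simp only at this
        rw [fmean_subRegate, h0, Finset.sum_empty] at this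
        exact lt_irrefl _ this
      obtain ⟨i, hi⟩ := hEne
      obtain ⟨_, _, _, iT, _⟩ := hget i
      obtain ⟨_, ix₁1, _, _, _, _⟩ := iT.lawFacts
      calc v c ≤ o c i * (L.get i).x₁ := hv c hc i hi
        _ ≤ 1 * (L.get i).x₁ := mul_le_mul_of_nonneg_right (ho1 c hc i hi) (by linarith [hv0 c hc, hv c hc i hi])
        _ < 1 := by rw [one_mul]; exact ix₁1
    have hK : ∀ t ∈ cmp c, 0 < t.q ∧ t.q ≤ 1 ∧ TreeBuiltN t.x₁ t.n t.M t.ρ ∧ v c ≤ t.q * t.x₁ := by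
      intro t ht
      obtain ⟨i, hi, rfl⟩ := (mem_subRegate L (E c) _ t).1 ht
      obtain ⟨_, _, _, iT, _⟩ := hget i
      exact ⟨ho0 c hc i hi, ho1 c hc i hi, iT, hv c hc i hi⟩
    have hKlaw : ∀ t ∈ cmp c, 0 ≤ t.q ∧ t.q ≤ 1 ∧ (∀ h, 0 ≤ t.ρ h) ∧ (∀ h, t.M < h → t.ρ h = 0) ∧
        ∑ h ∈ Finset.range (t.M + 1), t.ρ h = 1 := by
      intro t ht
      obtain ⟨tq0, tq1, tT, _⟩ := hK t ht
      obtain ⟨_, _, t0, tM, t1, _⟩ := tT.lawFacts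
      exact ⟨tq0.le, tq1, t0, tM, t1⟩
    obtain ⟨nE, hnE, hstrict, hTE⟩ := treeBuiltN_flaw_strict (hv0 c hc) hv1 (cmp c) hK
    obtain ⟨c0, cM, c1, cmn⟩ := flaw_facts_weak (cmp c) hKlaw
    obtain ⟨_, _, _, _, _, Fta⟩ := hTE.lawFacts
    -- ORACLE LEGALITY: fewer than `fgates L` nontrivial gates
    have hgates : fgates (cmp c) ≤ fgates L := fgates_subRegate_le L (E c) _
    have hlt : nE < fgates L := by
      obtain ⟨i, hi⟩ := hlegal c hc
      rcases hi with hi | hi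
      · -- a sibling is dropped: `fgates (cmp c) + (nᵢ + 1) ≤ fgates L`
        have h1 : fgates (cmp c) + ((L.get i).n + 1) ≤ fgates L := by
          show fgates (subRegate L (E c) (o c)) + ((L.get i).n + 1) ≤ fgates L
          rw [fgates_subRegate, fgates_eq_sum_get, ← Finset.add_sum_erase Finset.univ _ (Finset.mem_univ i), add_comm]
          exact Nat.add_le_add_left
            (Finset.sum_le_sum_of_subset_of_nonneg (fun j hj => Finset.mem_erase.2 ⟨by rintro rfl; exact hi hj, Finset.mem_univ j⟩)
              fun j _ _ => Nat.zero_le _) _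
        omega
      · -- a root is fully opened: the strict count
        by_cases hiE : i ∈ E c
        · have := hstrict ⟨regate (L.get i) (o c i), (mem_subRegate L (E c) _ _).2 ⟨i, hiE, rfl⟩, hi⟩
          omega
        · have h1 : fgates (cmp c) + ((L.get i).n + 1) ≤ fgates L := by
            show fgates (subRegate L (E c) (o c)) + ((L.get i).n + 1) ≤ fgates L
            rw [fgates_subRegate, fgates_eq_sum_get, ← Finset.add_sum_erase Finset.univ _ (Finset.mem_univ i), add_comm]
            exact Nat.add_le_add_left
              (Finset.sum_le_sum_of_subset_of_nonneg (fun j hj => Finset.mem_erase.2 ⟨by rintro rfl; exact hiE hj, Finset.mem_univ j⟩)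
                fun j _ _ => Nat.zero_le _) _
          omega
    have hSE : SDEC (v c) (ftop (cmp c)) (flaw (cmp c)) := hO (v c) nE _ _ hlt hTE
    have hzb : z ≤ b c * v c := by
      show a * x ≤ a * fmean L / fmean (cmp c) * v c
      rw [div_mul_eq_mul_div, le_div_iff₀ (hmc c hc)]
      have h1 : x * fmean (cmp c) ≤ fmean L * v c := hfloor c hc
      nlinarith
    have d := decAtT_gate_of_sdec (ftop (cmp c)) (flaw (cmp c)) (v c) (b c) z (hv0 c hc).le (hb0 c hc) (hb1 c hc)
      (mul_lt_one_aux (hb1 c hc) (hv0 c hc).le hv1) hzb c0 cM c1 Fta hSE j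
    rw [cmn] at d
    have eT : b c * fmean (cmp c) = TE := by
      show a * fmean L / fmean (cmp c) * fmean (cmp c) = a * fmean L
      exact div_mul_cancel₀ _ (hmc c hc).ne'
    rw [eT] at d
    exact decAtT_mono_top d (ftop_subRegate_le L (E c) _)
  have hmix : DECAtT z TE j (ftop L) (fun h => ∑ c ∈ S, w c * gate (flaw (cmp c)) (b c) h) :=
    decAtT_mixture_finset S w _ hw0 hw1 hUE
  obtain ⟨_, _, _, tmn⟩ := flaw_facts L hL'
  have hEmean : ∑ h ∈ Finset.range (ftop L + 1), (h : ℝ) * gate (flaw L) a h = TE := by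
    rw [sum_mul_gate, tmn]
  rw [decAt_iff_decAtT, hEmean, show gate (flaw L) a = fun h => ∑ c ∈ S, w c * gate (flaw (cmp c)) (b c) h from funext e]
  exact hmix

/-- **THE SUB-PRODUCT MIXTURE CRITERION (SDEC form).**  With the hypotheses of `decAt_gate_flaw_of_subproductMix` and all component means
`≥ fmean L`, the forest is SDEC at its true floor: `SDEC x (ftop L) (flaw L)` — the list form of the sibling step on every forest admitting such a
decomposition. [this work] -/
theorem sdec_flaw_of_subproductMix {x : ℝ} (hx0 : 0 < x) (hx1 : x < 1) (L : List Sib)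
    (hL : ∀ t ∈ L, t.TreeOK x) (hne : L ≠ [])
    (hO : ∀ (x' : ℝ) (n' M' : ℕ) (μ' : ℕ → ℝ), n' < fgates L → TreeBuiltN x' n' M' μ' → SDEC x' M' μ')
    {ι : Type*} (S : Finset ι) (u : ι → ℝ) (E : ι → Finset (Fin L.length)) (o : ι → Fin L.length → ℝ)
    (hu0 : ∀ c ∈ S, 0 ≤ u c)
    (ho0 : ∀ c ∈ S, ∀ i ∈ E c, 0 < o c i) (ho1 : ∀ c ∈ S, ∀ i ∈ E c, o c i ≤ 1)
    (hlegal : ∀ c ∈ S, ∃ i, i ∉ E c ∨ o c i = 1)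
    (hpat : ∀ A : Finset (Fin L.length), A.Nonempty →
      ∑ c ∈ S, u c * (if A ⊆ E c then (∏ i ∈ A, o c i) * ∏ i ∈ E c \ A, (1 - o c i) else 0)
        = (∏ i ∈ A, (L.get i).q) * ∏ i ∈ Finset.univ \ A, (1 - (L.get i).q))
    (v : ι → ℝ) (hv0 : ∀ c ∈ S, 0 < v c) (hv : ∀ c ∈ S, ∀ i ∈ E c, v c ≤ o c i * (L.get i).x₁)
    (hfloor : ∀ c ∈ S, x * fmean (subRegate L (E c) (o c)) ≤ fmean L * v c)
    (hm : ∀ c ∈ S, fmean L ≤ fmean (subRegate L (E c) (o c))) :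
    SDEC x (ftop L) (flaw L) := by
  intro a ha0 ha1 j hj
  refine decAt_gate_flaw_of_subproductMix hx0 hx1 L hL hne hO S u E o hu0 ho0 ho1 hlegal hpat v hv0 hv hfloor ha0 ha1
    (fun c hc => ?_) j hj
  have h0 : 0 ≤ fmean L := by
    rw [fmean_eq_sum_get]
    exact Finset.sum_nonneg fun i _ =>
      mul_nonneg (hL _ (List.get_mem L i)).1.le ((L.get i).mean_pos (hL _ (List.get_mem L i))).le
  calc a * fmean L ≤ 1 * fmean L := mul_le_mul_of_nonneg_right ha1 h0
    _ = fmean L := one_mul _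
    _ ≤ _ := hm c hc

end LawDec
end Quant
end Summit.CriticalPhenomena.PercolationContinuityZ3.Theorems
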